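import Summits.ValiantsHypothesis.ValiantsHypothesis.Theses.FermionizationDimension
import Summits.ValiantsHypothesis.ValiantsHypothesis.Theses.TwistedDetRank
import Summits.ValiantsHypothesis.ValiantsHypothesis.Theorems.TwistedDetRankTdrSuperadditive

/-!
# Route FermionizationDimension — crux `SDimPerNotQP` (stmt-ValiantsHypothesis-7286):
# the two open stubs of the line cannot both fail

Auxiliary registered stub `stub_betOrSemisimple` of the line `registered` of
`Cruxes/SDimPerNotQP/Lines/birth.lean`. The line proves the crux from X1_ss =
`TwistedDetRank.TdrPerNotQP` (stmt-ValiantsHypothesis-6284) and the bet J_tr,small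
("semisimplification at quasi-polynomial cost": every commutative realisation of `sgn_n` of
dimension `d < 2^n` yields a REDUCED realisation of dimension `≤ 2^((log₂(d+n)+c)^c)`). This file
records that J_tr,small ∨ X1_ss holds unconditionally: if X1_ss fails, i.e. `per_n` is a sum of
`r ≤ 2^((log₂ n + c)^c)` Hadamard-twisted determinants for every `n`, then that representation IS a
reduced realisation over `Fin r → ℂ` of dimension `r ≤ 2^((log₂(d+n)+c)^c)` for every `d`, which is
J_tr,small with the same constant. Consequence for the chain: the bet J_tr,small cannot be refuted
without PROVING the sibling crux stmt-6284; the line can only die together with X1_ss.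

Sources: folklore.
-/

-- `Summit.<Summit>.<Problem>` repeats `ValiantsHypothesis` by the tree's layout convention (D-0017).
set_option linter.dupNamespace false

namespace Summit.ValiantsHypothesis.ValiantsHypothesis.Theorems

open Literature.Computability.AlgebraicComplexity in
/-- **The bet or the semisimple lower bound** (auxiliary registered stub `stub_betOrSemisimple` of
the line `registered` of crux `SDimPerNotQP`, stmt-ValiantsHypothesis-7286): J_tr,small ∨
`TwistedDetRank.TdrPerNotQP` — a quasi-polynomial twisted-determinantal representation of every
`per_n` would itself be the cheap reduced realisation J_tr,small asks for. [folklore] -/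
theorem stub_betOrSemisimple :
    (∃ c : ℕ, ∀ (n : ℕ) (R : Type) [CommRing R] [Algebra ℂ R] [Module.Finite ℂ R] (u : Fin n → Fin n → R) (ℓ : R →ₗ[ℂ] ℂ), (∀ σ : Equiv.Perm (Fin n), ℓ (∏ i, u (σ i) i) = ((Equiv.Perm.sign σ : ℤ) : ℂ)) → Module.finrank ℂ R < 2 ^ n → ∃ (R' : Type) (_ : CommRing R') (_ : Algebra ℂ R') (_ : Module.Finite ℂ R') (_ : IsReduced R') (u' : Fin n → Fin n → R') (ℓ' : R' →ₗ[ℂ] ℂ), (∀ σ : Equiv.Perm (Fin n), ℓ' (∏ i, u' (σ i) i) = ((Equiv.Perm.sign σ : ℤ) : ℂ)) ∧ Module.finrank ℂ R' ≤ 2 ^ ((Nat.log 2 (Module.finrank ℂ R + n) + c) ^ c)) ∨ Summit.ValiantsHypothesis.ValiantsHypothesis.Theses.TwistedDetRank.TdrPerNotQP := by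
  by_cases hT : Summit.ValiantsHypothesis.ValiantsHypothesis.Theses.TwistedDetRank.TdrPerNotQP
  · exact Or.inr hT
  · refine Or.inl ?_
    unfold Summit.ValiantsHypothesis.ValiantsHypothesis.Theses.TwistedDetRank.TdrPerNotQP at hT
    push Not at hT
    obtain ⟨c, hc⟩ := hT
    refine ⟨c, fun n R _ _ _ _ _ _ _ => ?_⟩
    obtain ⟨r, hr, E, hE⟩ := hc n
    -- coefficient form of the representation: `sgn σ = Σ_t ∏ i, E t (σ i) i`
    have hpat := (TwistedDetRankTdrSuperadditive.perPoly_eq_sum_twistedDet_iff E).1 hE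
    -- the semisimple realisation over `Fin r → ℂ`
    have hreal : ∀ σ : Equiv.Perm (Fin n),
        (∑ t, (LinearMap.proj t : (Fin r → ℂ) →ₗ[ℂ] ℂ)) (∏ i, (fun t => E t (σ i) i)) =
          ((Equiv.Perm.sign σ : ℤ) : ℂ) := by
      intro σ
      rw [LinearMap.sum_apply, hpat σ]
      refine Finset.sum_congr rfl fun t _ => ?_
      simp [Finset.prod_apply]
    refine ⟨Fin r → ℂ, inferInstance, inferInstance, inferInstance, inferInstance,
      fun i j t => E t i j, ∑ t, (LinearMap.proj t : (Fin r → ℂ) →ₗ[ℂ] ℂ), hreal, ?_⟩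
    rw [Module.finrank_fintype_fun_eq_card, Fintype.card_fin]
    refine hr.trans (Nat.pow_le_pow_right (by norm_num) (Nat.pow_le_pow_left ?_ c))
    exact Nat.add_le_add_right (Nat.log_mono_right (Nat.le_add_left n _)) c

end Summit.ValiantsHypothesis.ValiantsHypothesis.Theorems
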